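import Mathlib
import Summits.NavierStokesRegularity.NavierStokesRegularity.Theorems.EulerZoomLiouvillePowerGaugeEulerLiouvilleDSSSwirlCasimir
import Summits.NavierStokesRegularity.NavierStokesRegularity.Theorems.EulerZoomLiouvillePowerGaugeEulerLiouvilleAxisymDSSPow
import Literature.Analysis.FluidPDE.AxisymQuotientEquationsOmega
import Literature.Analysis.FluidPDE.HouLiSpaceTime
import Literature.Analysis.FluidPDE.BackwardParticleMap
import HarnessLib

/-!
# Crux E `PowerGaugeEulerLiouville` (stmt-NavierStokesRegularity-19832): THE DISCRETE `η`-RATCHET — the axisymmetric DSS stratum with ONE-SLICE hypotheses: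
# `η = ω_θ/r` BOUNDED, or of FINITE-VOLUME SUPPORT, or in ONE `L^q` with `q(3+ρ) ≠ 3`, on ONE past slice (width seat ns-ezl-w3 g3)

Route №10 `EulerZoomLiouville` (NavierStokesRegularity), crux E; LEAD ns-typeII-p2 g12; the axisymmetric DSS branch of `stub_nonSelfSimilarRest` (`IsDSSClassicalTame ρ u p`).
Third file of the discrete-ratchet chain (`…DSSSwirlRatchet` p644925: bounded swirl on one slice; `…DSSSwirlCasimir` p646151: swirl of finite support / one `L^q`
Casimir `qρ ≠ 3` on one slice).  The swirl-free DSS endgame of ns-typeII-p3 (`AxisymNoSwirl.ae_eq_zero_of_gauge_of_axisymNoSwirl_dss`, `…_dss_pow`) asks for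
`η = ω_θ/r ∈ L^{2m}` UNIFORMLY on compact past intervals.  Here `η` gets the same treatment as the swirl:

* TRANSPORT.  Without swirl, Ukhovskii–Yudovich / MB (4.60): `∂ₜη + Dη[u] = 0` pointwise on `(−∞,0)` (`angVortQuot_transport`, the tree's `Ω`-equation
  `IsClassicalNSSolutionOn.angVortQuot_eq` at `ν = 0`, `u^θ ≡ 0`), hence `η(τ₂, x) = η(τ₁, φ(τ₂ → τ₁) x)` (`angVortQuot_eq_angVortQuot_evolutionMap`) and, the two-time maps
  preserving volume (`DSSSwirlRatchet.measurePreserving_evolutionMap_past`), **the distribution function `n(ν) = vol{ν < |η(τ,·)|}` is the same on every past slice**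
  (`volume_superlevel_angVortQuot_eq`).
* DSS.  `u(τ,y) = l^{1+ρ} u(l^{2+ρ}τ, l y)` gives `η(τ, y) = l^{3+ρ} η(l^{2+ρ}τ, l y)` (`angVortQuot_dss`), so **`n(ν) = l³ · n(l^{3+ρ} ν)`** (`volume_superlevel_angVortQuot_law`):
  the SAME law as the swirl's `m(μ) = l³ m(l^ρ μ)` with the exponent `ρ` replaced by `3 + ρ`.
* ABSTRACT RATCHET (`n : ℝ → ℝ≥0∞` with `n(ν) = b · n(a ν)`): `law_iterate`, `law_iterate_down`, and three kills — `null_of_law_of_vanishing_above` (`n = 0` above a level `B`,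
  `a > 1` ⇒ `n = 0` at every positive level), `null_of_law_of_le` (`n ≤ M < ∞` at positive levels, `b > 1` ⇒ `n = 0`), `null_of_law_of_chebyshev` (`ν^q n(ν) ≤ I < ∞`,
  `a = l^e`, `b = l³`, `qe ≠ 3` ⇒ `n = 0`; `DSSSwirlRatchet.eq_zero_of_geometric_ratchet`).
* KILLS: `angVortQuot_eq_zero_of_dss_of_bounded / _of_finiteSupport / _of_Lq` — `η ≡ 0` on EVERY slice from the one-slice hypothesis; then `curl u(τ,·) ≡ 0`
  (`AxisymNoSwirl.curl_eq_zero_of_angVortQuot_eq_zero`) and the member vanishes (`AxisymNoSwirl.ae_eq_zero_of_gauge_of_curl_slice_eq_zero`, `A`-gauge only).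
* MEMBER FORMS: `ae_eq_zero_of_gauge_of_axisymNoSwirl_dss_eta` (swirl-free slices + one-slice `η` clause) and THE ONE-SLICE AXISYMMETRIC DSS STRATUM
  `ae_eq_zero_of_gauge_of_axisym_dss_oneSlice`: classical axisymmetric `l`-DSS member, `u`/`∇u` bounded on compact past intervals, and on ONE slice `τ₀ < 0`
  BOTH a swirl clause (`|r u_θ| ≤ B` ∨ `vol{r u_θ ≠ 0} < ⊤` ∨ `∫⁻|r u_θ|^q < ⊤, q > 0, qρ ≠ 3`) AND an `η` clause (`|η| ≤ B` ∨ `vol{η ≠ 0} < ⊤` ∨ `∫⁻|η|^q < ⊤, q > 0, q(3+ρ) ≠ 3`)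
  ⇒ `u = 0` a.e. — NO time-uniform integrability hypothesis left.  For the LEAD: the axisymmetric alternative of `IsDSSClassicalTame` may take exactly these two clauses.

WHAT THIS IS NOT: not NS regularity, not the crux E — a widening of one DSS stratum of the crux CLASS 19832 (MODEL lattice; E/NS strata) `--supports` stmt-19832; the
DSS-critical Casimirs `q = 3/ρ` (swirl) and `q = 3/(3+ρ)` (`η`) stay open; 19832 OPEN.
[folklore; MajdaBertozziCUP2002 §1.3 Prop. 1.4, §4.3 (4.60); UkhovskiiYudovich1968; Chae2007CMPEuler Thm 2.2 + Note added p. 6 (continuous-scaling original)]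
-/

noncomputable section

-- flat `Theorems/<Route><Decl>…` files of one crux share the namespace of the crux (tree convention: `Summit.<S>.<S>.…`)
set_option linter.dupNamespace false

open MeasureTheory Set Filter Topology Metric Function InnerProductSpace
open scoped RealInnerProductSpace NNReal ENNReal ContDiff

namespace Summit.NavierStokesRegularity.NavierStokesRegularity.Theorems.PowerGaugeEulerLiouville

open Literature.Analysis Literature.Analysis.FluidPDE Literature.Analysis.FunctionSpaces

/-! ### The abstract discrete ratchet for a distribution-type function `n : ℝ → ℝ≥0∞` with `n(ν) = b · n(a ν)` -/

namespace DSSSwirlRatchet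

/-- **Iterating the law up: `n(ν) = b^k · n(a^k ν)`.** [folklore] -/
theorem law_iterate {n : ℝ → ℝ≥0∞} {a b : ℝ} (hb : 0 ≤ b) (hlaw : ∀ ν : ℝ, n ν = ENNReal.ofReal b * n (a * ν)) (k : ℕ) (ν : ℝ) :
    n ν = ENNReal.ofReal (b ^ k) * n (a ^ k * ν) := by
  induction k generalizing ν with
  | zero => simp only [pow_zero, ENNReal.ofReal_one, one_mul]
  | succ k ih =>
    rw [ih ν, hlaw (a ^ k * ν), ← mul_assoc, ← mul_assoc, ← ENNReal.ofReal_mul (pow_nonneg hb k), ← pow_succ, ← pow_succ']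

/-- **Iterating the law down: `n(a^{−k} ν) = b^k · n(ν)`** (`a ≠ 0`). [folklore] -/
theorem law_iterate_down {n : ℝ → ℝ≥0∞} {a b : ℝ} (ha : a ≠ 0) (hb : 0 ≤ b) (hlaw : ∀ ν : ℝ, n ν = ENNReal.ofReal b * n (a * ν))
    (k : ℕ) (ν : ℝ) : n ((a ^ k)⁻¹ * ν) = ENNReal.ofReal (b ^ k) * n ν := by
  rw [law_iterate hb hlaw k ((a ^ k)⁻¹ * ν), ← mul_assoc, mul_inv_cancel₀ (pow_ne_zero k ha), one_mul]

/-- **Kill 1 (bounded quantity): if `n` vanishes above some level `B` and `a > 1`, then `n(ν) = 0` for every `ν > 0`** (`n(ν) = b^k n(a^k ν)` and `a^k ν > B`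
for `k` large). [folklore] -/
theorem null_of_law_of_vanishing_above {n : ℝ → ℝ≥0∞} {a b B : ℝ} (ha : 1 < a) (hb : 0 ≤ b)
    (hlaw : ∀ ν : ℝ, n ν = ENNReal.ofReal b * n (a * ν)) (hB : ∀ ν : ℝ, B < ν → n ν = 0) {ν : ℝ} (hν : 0 < ν) : n ν = 0 := by
  obtain ⟨k, hk⟩ := pow_unbounded_of_one_lt (B / ν) ha
  rw [law_iterate hb hlaw k ν, hB _ ((div_lt_iff₀ hν).1 hk), mul_zero]

/-- **Kill 2 (finite bound at positive levels): if `n(ν′) ≤ M < ∞` for all `ν′ > 0`, `a > 0` and `b > 1`, then `n(ν) = 0` for every `ν > 0`**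
(`b^k n(ν) = n(a^{−k}ν) ≤ M`; `DSSSwirlRatchet.eq_zero_of_geometric_ratchet`). [folklore] -/
theorem null_of_law_of_le {n : ℝ → ℝ≥0∞} {a b : ℝ} {M : ℝ≥0∞} (ha : 0 < a) (hb : 1 < b)
    (hlaw : ∀ ν : ℝ, n ν = ENNReal.ofReal b * n (a * ν)) (hM : M ≠ ⊤) (hle : ∀ ν : ℝ, 0 < ν → n ν ≤ M) {ν : ℝ} (hν : 0 < ν) :
    n ν = 0 := by
  refine eq_zero_of_geometric_ratchet hb hM fun k => ?_
  rw [← law_iterate_down ha.ne' (zero_le_one.trans hb.le) hlaw k ν]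
  exact hle _ (mul_pos (inv_pos.2 (pow_pos ha k)) hν)

/-- **Kill 3 (Chebyshev off the critical exponent): `n(ν) = l³ · n(l^e ν)` (`l > 1`), `ν^q n(ν) ≤ I < ∞` for all `ν > 0` with `0 < q` and `qe ≠ 3` ⇒ `n(ν) = 0` for
every `ν > 0`.**  (`qe < 3`: `ν^q (l^{3−qe})^k n(ν) ≤ I` from the levels `l^{−ke}ν`; `qe > 3`: `ν^q (l^{qe−3})^k n(ν) ≤ I` from the levels `l^{ke}ν`; a geometric
ratchet either way; meaningful for `q > 0`.  `qe = 3` is the scale-invariant case and nothing follows.) [cite: Chae2007CMPEuler, Thm 2.2 + Note added p. 6 (continuous-scaling original)] -/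
theorem null_of_law_of_chebyshev {n : ℝ → ℝ≥0∞} {l e q : ℝ} {I : ℝ≥0∞} (hl : 1 < l)
    (hlaw : ∀ ν : ℝ, n ν = ENNReal.ofReal (l ^ (3 : ℕ)) * n (l ^ e * ν)) (hqe : q * e ≠ 3) (hI : I ≠ ⊤)
    (hcheb : ∀ ν : ℝ, 0 < ν → ENNReal.ofReal (ν ^ q) * n ν ≤ I) {ν : ℝ} (hν : 0 < ν) : n ν = 0 := by
  have hl0 : 0 < l := by linarith
  have hle : 0 < l ^ e := Real.rpow_pos_of_pos hl0 _
  have hl3 : 0 ≤ l ^ (3 : ℕ) := pow_nonneg hl0.le 3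
  have hνq : 0 < ν ^ q := Real.rpow_pos_of_pos hν _
  suffices hsuff : ENNReal.ofReal (ν ^ q) * n ν = 0 by
    rcases mul_eq_zero.1 hsuff with h0 | h0
    · exact absurd h0 (ENNReal.ofReal_pos.2 hνq).ne'
    · exact h0
  have hpowq : ∀ k : ℕ, ((l ^ e) ^ k) ^ q = (l ^ (q * e)) ^ k := by
    intro k
    rw [← Real.rpow_natCast, ← Real.rpow_natCast, ← Real.rpow_mul hle.le, mul_comm (k : ℝ) q, Real.rpow_mul hle.le,
      ← Real.rpow_mul hl0.le, mul_comm e q]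
  have h3 : l ^ (3 : ℝ) = l ^ (3 : ℕ) := by exact_mod_cast Real.rpow_natCast l 3
  rcases lt_or_gt_of_ne hqe with hlt | hgt
  · have hb : 1 < l ^ (3 - q * e) := Real.one_lt_rpow hl (by linarith)
    refine eq_zero_of_geometric_ratchet hb hI fun k => ?_
    have hν' : 0 < ((l ^ e) ^ k)⁻¹ * ν := mul_pos (inv_pos.2 (pow_pos hle k)) hν
    have hc := hcheb _ hν'
    rw [law_iterate_down hle.ne' hl3 hlaw k ν, ← mul_assoc, ← ENNReal.ofReal_mul (Real.rpow_nonneg hν'.le _)] at hc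
    have hA : (l ^ (3 - q * e)) ^ k = (l ^ (3 : ℕ)) ^ k / (l ^ (q * e)) ^ k := by
      rw [← div_pow, Real.rpow_sub hl0, h3]
    have hB : (((l ^ e) ^ k)⁻¹ * ν) ^ q = ν ^ q / (l ^ (q * e)) ^ k := by
      rw [Real.mul_rpow (inv_nonneg.2 (pow_nonneg hle.le k)) hν.le, Real.inv_rpow (pow_nonneg hle.le k), hpowq k, inv_mul_eq_div]
    have hreal : (l ^ (3 - q * e)) ^ k * ν ^ q = (((l ^ e) ^ k)⁻¹ * ν) ^ q * (l ^ (3 : ℕ)) ^ k := by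
      rw [hA, hB]; ring
    calc ENNReal.ofReal ((l ^ (3 - q * e)) ^ k) * (ENNReal.ofReal (ν ^ q) * n ν)
        = ENNReal.ofReal ((l ^ (3 - q * e)) ^ k * ν ^ q) * n ν := by
          rw [← mul_assoc, ← ENNReal.ofReal_mul (pow_nonneg (zero_le_one.trans hb.le) k)]
      _ = ENNReal.ofReal ((((l ^ e) ^ k)⁻¹ * ν) ^ q * (l ^ (3 : ℕ)) ^ k) * n ν := by rw [hreal]
      _ ≤ I := hc
  · have hb : 1 < l ^ (q * e - 3) := Real.one_lt_rpow hl (by linarith)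
    refine eq_zero_of_geometric_ratchet hb hI fun k => ?_
    have hν' : 0 < (l ^ e) ^ k * ν := mul_pos (pow_pos hle k) hν
    have hc := hcheb _ hν'
    have hA : (l ^ (q * e - 3)) ^ k = (l ^ (q * e)) ^ k / (l ^ (3 : ℕ)) ^ k := by
      rw [← div_pow, Real.rpow_sub hl0, h3]
    have hreal : (l ^ (q * e - 3)) ^ k * ν ^ q * (l ^ (3 : ℕ)) ^ k = ((l ^ e) ^ k * ν) ^ q := by
      rw [Real.mul_rpow (pow_nonneg hle.le k) hν.le, hpowq k, hA]
      field_simp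
    calc ENNReal.ofReal ((l ^ (q * e - 3)) ^ k) * (ENNReal.ofReal (ν ^ q) * n ν)
        = ENNReal.ofReal ((l ^ (q * e - 3)) ^ k) * (ENNReal.ofReal (ν ^ q) * (ENNReal.ofReal ((l ^ (3 : ℕ)) ^ k) * n ((l ^ e) ^ k * ν))) := by
          rw [law_iterate hl3 hlaw k ν]
      _ = ENNReal.ofReal ((l ^ (q * e - 3)) ^ k * ν ^ q * (l ^ (3 : ℕ)) ^ k) * n ((l ^ e) ^ k * ν) := by
          rw [← mul_assoc, ← mul_assoc, ← ENNReal.ofReal_mul (pow_nonneg (zero_le_one.trans hb.le) k),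
            ← ENNReal.ofReal_mul (mul_nonneg (pow_nonneg (zero_le_one.trans hb.le) k) hνq.le)]
      _ = ENNReal.ofReal (((l ^ e) ^ k * ν) ^ q) * n ((l ^ e) ^ k * ν) := by rw [hreal]
      _ ≤ I := hc

end DSSSwirlRatchet

/-! ### `η = ω_θ/r` along a classical axisymmetric swirl-free DSS member on `(−∞, 0)` -/

namespace DSSEtaRatchet

open DSSSwirlRatchet

variable {u : ℝ → EuclideanSpace ℝ (Fin 3) → EuclideanSpace ℝ (Fin 3)} {p : ℝ → EuclideanSpace ℝ (Fin 3) → ℝ}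

/-- **`∂ₜη + Dη[u] = 0` on `(−∞, 0)`** for a classical swirl-free axisymmetric Euler flow (the tree's `Ω`-equation at `ν = 0`, `u^θ/r ≡ 0`, and
`∂ₜ angVortQuot = angVortQuot ∂ₜ`; the `Icc` version is `AxisymNoSwirl.timeDerivWithin_angVortQuot_eq_neg`). [cite: MajdaBertozziCUP2002, §4.3 eq. (4.60)] -/
theorem angVortQuot_transport (hns : IsClassicalNSSolutionOn (Iio 0) 0 0 u p)
    (hax : ∀ τ : ℝ, τ < 0 → IsAxisymmetric (u τ)) (hsw : ∀ τ : ℝ, τ < 0 → HasNoSwirl (u τ))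
    {s : ℝ} (hs : s < 0) (x : EuclideanSpace ℝ (Fin 3)) :
    FluidPDE.timeDerivWithin (Iio 0) (fun σ => angVortQuot (u σ)) s x + fderiv ℝ (angVortQuot (u s)) x (u s x) = 0 := by
  have hS : UniqueDiffOn ℝ (Iio (0 : ℝ)) := uniqueDiffOn_Iio 0
  have hcl : Iio (0 : ℝ) ⊆ closure (interior (Iio 0)) := by
    rw [interior_Iio]; exact subset_closure
  have hax' : ∀ σ ∈ Iio (0 : ℝ), IsAxisymmetric (u σ) := fun σ hσ => hax σ hσ
  have h1 := hns.smooth_velocity.timeDerivWithin_angVortQuot (convex_Iio 0) hS hcl hax' hs x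
  have h2 := hns.angVortQuot_eq hS hcl hax' hs x
  rw [AxisymNoSwirl.angVelQuot_eq_zero_of_hasNoSwirl (hsw s hs)] at h2
  simp only [zero_mul, Pi.zero_apply, mul_zero, sub_zero] at h2
  rw [h1]
  linarith

/-- **`η(τ₂, x) = η(τ₁, φ(τ₂ → τ₁) x)`** for all `τ₁, τ₂ < 0` (characteristics of `∂ₜη + Dη[u] = 0`, `η` jointly smooth, Cauchy–Lipschitz hypotheses on `u`).
[cite: MajdaBertozziCUP2002, §4.3 eq. (4.60), §1.6 (1.53)] -/
theorem angVortQuot_eq_angVortQuot_evolutionMap (hns : IsClassicalNSSolutionOn (Iio 0) 0 0 u p)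
    (hax : ∀ τ : ℝ, τ < 0 → IsAxisymmetric (u τ)) (hsw : ∀ τ : ℝ, τ < 0 → HasNoSwirl (u τ))
    (hL : ODE.IsUniformlyLipschitzOn u (Iio 0)) {τ₁ τ₂ : ℝ} (hτ₁ : τ₁ < 0) (hτ₂ : τ₂ < 0) (x : EuclideanSpace ℝ (Fin 3)) :
    angVortQuot (u τ₂) x = angVortQuot (u τ₁) (ODE.evolutionMap u τ₂ τ₁ x) := by
  have hf : IsSmoothSpaceTimeOn (Iio 0) (fun s => angVortQuot (u s)) :=
    hns.smooth_velocity.angVortQuot_family (convex_Iio 0) (uniqueDiffOn_Iio 0)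
  exact eq_apply_evolutionMap_target_of_transport_eq_zero hL (convex_Iio 0) hf
    (fun s hs y => angVortQuot_transport hns hax hsw hs y) hτ₁ hτ₂ x

/-- `η(τ, ·)` is continuous on every past slice of a classical solution. [folklore] -/
theorem continuous_angVortQuot_slice (hns : IsClassicalNSSolutionOn (Iio 0) 0 0 u p) {τ : ℝ} (hτ : τ < 0) :
    Continuous (angVortQuot (u τ)) :=
  ((hns.smooth_velocity.angVortQuot_family (convex_Iio 0) (uniqueDiffOn_Iio 0)).contDiff_slice hτ).continuous

/-- **The distribution function of `η` is the same on every past slice**: `vol{ν < |η(τ,·)|} = vol{ν < |η(τ′,·)|}`, `τ, τ′ < 0` (preimage under the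
measure-preserving `φ(τ → τ′)`). [cite: MajdaBertozziCUP2002, §1.7 Cor. 1.4 (iv), the same mechanism] -/
theorem volume_superlevel_angVortQuot_eq (hns : IsClassicalNSSolutionOn (Iio 0) 0 0 u p)
    (hax : ∀ τ : ℝ, τ < 0 → IsAxisymmetric (u τ)) (hsw : ∀ τ : ℝ, τ < 0 → HasNoSwirl (u τ))
    (hL : ODE.IsUniformlyLipschitzOn u (Iio 0)) {τ τ' : ℝ} (hτ : τ < 0) (hτ' : τ' < 0) (ν : ℝ) :
    volume {y : EuclideanSpace ℝ (Fin 3) | ν < |angVortQuot (u τ) y|} =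
      volume {y : EuclideanSpace ℝ (Fin 3) | ν < |angVortQuot (u τ') y|} := by
  have hset : {y : EuclideanSpace ℝ (Fin 3) | ν < |angVortQuot (u τ) y|} =
      ODE.evolutionMap u τ τ' ⁻¹' {y | ν < |angVortQuot (u τ') y|} := by
    ext y; simp only [mem_setOf_eq, mem_preimage]; rw [angVortQuot_eq_angVortQuot_evolutionMap hns hax hsw hL hτ' hτ y]
  have hopen : IsOpen {y : EuclideanSpace ℝ (Fin 3) | ν < |angVortQuot (u τ') y|} :=
    isOpen_lt continuous_const (continuous_abs.comp (continuous_angVortQuot_slice hns hτ'))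
  rw [hset]
  exact (measurePreserving_evolutionMap_past hns hL hτ hτ').measure_preimage hopen.measurableSet.nullMeasurableSet

/-- **DSS scaling of `η`**: `u(τ, y) = l^{1+ρ} u(l^{2+ρ}τ, l y)` gives `η(τ, y) = l^{3+ρ} · η(l^{2+ρ}τ, l y)` (`η` of `c • v(l •)` is `c l² · η(v)(l •)`,
`AxisymNoSwirl.angVortQuot_smul_comp_smul`). [folklore] -/
theorem angVortQuot_dss {ρ : ℝ} (hns : IsClassicalNSSolutionOn (Iio 0) 0 0 u p)
    (hax : ∀ τ : ℝ, τ < 0 → IsAxisymmetric (u τ)) {l : ℝ} (hl : 1 < l)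
    (hdss : ∀ τ : ℝ, τ < 0 → ∀ y, u τ y = (l ^ (1 + ρ)) • u ((l ^ (2 + ρ)) * τ) (l • y))
    {τ : ℝ} (hτ : τ < 0) (y : EuclideanSpace ℝ (Fin 3)) :
    angVortQuot (u τ) y = l ^ (3 + ρ) * angVortQuot (u ((l ^ (2 + ρ)) * τ)) (l • y) := by
  have hl0 : 0 < l := by linarith
  have hσ : (l ^ (2 + ρ)) * τ < 0 := mul_neg_of_pos_of_neg (Real.rpow_pos_of_pos hl0 _) hτ
  have hfun : u τ = fun z => (l ^ (1 + ρ)) • u ((l ^ (2 + ρ)) * τ) (l • z) := funext fun z => hdss τ hτ z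
  have h3 : ContDiff ℝ 3 (u ((l ^ (2 + ρ)) * τ)) := (hns.contDiff_velocity hσ).of_le (by norm_cast)
  have h := congrFun (AxisymNoSwirl.angVortQuot_smul_comp_smul (hax _ hσ) h3 (l ^ (1 + ρ)) l) y
  rw [← hfun] at h
  rw [h]
  congr 1
  rw [show (3 : ℝ) + ρ = (1 + ρ) + 2 by ring, Real.rpow_add hl0 (1 + ρ) 2, Real.rpow_two]

/-- **The DSS law of the `η`-distribution: `n(ν) = l³ · n(l^{3+ρ} ν)`** (`n(ν) = vol{ν < |η(τ,·)|}`, any `τ < 0`): the superlevel set `{ν < |η(σ,·)|}` at the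
earlier time `σ = l^{2+ρ}τ` is the `l⁻¹`-homothetic preimage of `{l^{3+ρ}ν < |η(τ,·)|}`; then slice independence. [folklore] -/
theorem volume_superlevel_angVortQuot_law {ρ : ℝ} (hns : IsClassicalNSSolutionOn (Iio 0) 0 0 u p)
    (hax : ∀ τ : ℝ, τ < 0 → IsAxisymmetric (u τ)) (hsw : ∀ τ : ℝ, τ < 0 → HasNoSwirl (u τ))
    (hL : ODE.IsUniformlyLipschitzOn u (Iio 0)) {l : ℝ} (hl : 1 < l)
    (hdss : ∀ τ : ℝ, τ < 0 → ∀ y, u τ y = (l ^ (1 + ρ)) • u ((l ^ (2 + ρ)) * τ) (l • y))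
    {τ : ℝ} (hτ : τ < 0) (ν : ℝ) :
    volume {y : EuclideanSpace ℝ (Fin 3) | ν < |angVortQuot (u τ) y|} =
      ENNReal.ofReal (l ^ (3 : ℕ)) * volume {y : EuclideanSpace ℝ (Fin 3) | l ^ (3 + ρ) * ν < |angVortQuot (u τ) y|} := by
  have hl0 : 0 < l := by linarith
  have hle : 0 < l ^ (3 + ρ) := Real.rpow_pos_of_pos hl0 _
  set σ : ℝ := (l ^ (2 + ρ)) * τ with hσdef
  have hσ : σ < 0 := mul_neg_of_pos_of_neg (Real.rpow_pos_of_pos hl0 _) hτ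
  -- the superlevel set at `σ` as a homothetic preimage of the one at `τ`
  have hset : {w : EuclideanSpace ℝ (Fin 3) | ν < |angVortQuot (u σ) w|} =
      (fun w : EuclideanSpace ℝ (Fin 3) => l⁻¹ • w) ⁻¹' {y | l ^ (3 + ρ) * ν < |angVortQuot (u τ) y|} := by
    ext w
    simp only [mem_setOf_eq, mem_preimage]
    rw [angVortQuot_dss hns hax hl hdss hτ (l⁻¹ • w), smul_inv_smul₀ hl0.ne', abs_mul, abs_of_pos hle, mul_lt_mul_iff_right₀ hle]
  rw [volume_superlevel_angVortQuot_eq hns hax hsw hL hτ hσ ν, hset, Measure.addHaar_preimage_smul volume (inv_ne_zero hl0.ne'),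
    finrank_euclideanSpace_fin, inv_pow, inv_inv, abs_of_pos (pow_pos hl0 3)]

/-! ### The kills: `η ≡ 0` on every slice from a one-slice hypothesis -/

/-- From null superlevel sets to `η ≡ 0` on a slice (continuity). [folklore] -/
theorem angVortQuot_eq_zero_of_null_superlevels (hns : IsClassicalNSSolutionOn (Iio 0) 0 0 u p) {τ : ℝ} (hτ : τ < 0)
    (hnull : ∀ ν : ℝ, 0 < ν → volume {y : EuclideanSpace ℝ (Fin 3) | ν < |angVortQuot (u τ) y|} = 0) :
    ∀ y, angVortQuot (u τ) y = 0 := by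
  have hc := continuous_angVortQuot_slice hns hτ
  intro y
  by_contra hne
  have hν : 0 < |angVortQuot (u τ) y| / 2 := by positivity
  have hopen : IsOpen {z : EuclideanSpace ℝ (Fin 3) | |angVortQuot (u τ) y| / 2 < |angVortQuot (u τ) z|} :=
    isOpen_lt continuous_const (continuous_abs.comp hc)
  have hempty := (hopen.measure_eq_zero_iff volume).1 (hnull _ hν)
  have hy : y ∈ {z : EuclideanSpace ℝ (Fin 3) | |angVortQuot (u τ) y| / 2 < |angVortQuot (u τ) z|} := by
    show |angVortQuot (u τ) y| / 2 < |angVortQuot (u τ) y|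
    linarith [abs_pos.2 hne]
  rw [hempty] at hy
  exact hy

/-- **BOUNDED `η` ON ONE SLICE ⇒ `η ≡ 0` ON EVERY SLICE** (`ρ > −3`): `n = 0` above `B`, and `n(ν) = l^{3k} n(l^{k(3+ρ)}ν)` with `l^{k(3+ρ)}ν > B` eventually.
[cite: MajdaBertozziCUP2002, §4.3 eq. (4.60)] -/
theorem angVortQuot_eq_zero_of_dss_of_bounded {ρ : ℝ} (hρ : -3 < ρ) (hns : IsClassicalNSSolutionOn (Iio 0) 0 0 u p)
    (hax : ∀ τ : ℝ, τ < 0 → IsAxisymmetric (u τ)) (hsw : ∀ τ : ℝ, τ < 0 → HasNoSwirl (u τ))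
    (hL : ODE.IsUniformlyLipschitzOn u (Iio 0)) {l : ℝ} (hl : 1 < l)
    (hdss : ∀ τ : ℝ, τ < 0 → ∀ y, u τ y = (l ^ (1 + ρ)) • u ((l ^ (2 + ρ)) * τ) (l • y))
    {τ₀ : ℝ} (hτ₀ : τ₀ < 0) {B : ℝ} (hB : ∀ y, |angVortQuot (u τ₀) y| ≤ B) :
    ∀ τ : ℝ, τ < 0 → ∀ y, angVortQuot (u τ) y = 0 := by
  have ha : 1 < l ^ (3 + ρ) := Real.one_lt_rpow hl (by linarith)
  intro τ hτ
  refine angVortQuot_eq_zero_of_null_superlevels hns hτ fun ν hν => ?_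
  rw [volume_superlevel_angVortQuot_eq hns hax hsw hL hτ hτ₀ ν]
  refine null_of_law_of_vanishing_above (B := B) ha (pow_nonneg (by linarith) 3)
    (fun ν' => volume_superlevel_angVortQuot_law hns hax hsw hL hl hdss hτ₀ ν') (fun ν' hν' => ?_) hν
  -- no point exceeds the level `ν' > B`
  exact measure_mono_null (fun y (hy : ν' < |angVortQuot (u τ₀) y|) => (lt_irrefl B ((hν'.trans hy).trans_le (hB y))).elim)
    measure_empty

/-- **`η` OF FINITE-VOLUME SUPPORT ON ONE SLICE ⇒ `η ≡ 0` ON EVERY SLICE** (any real `ρ`): `l^{3k} n(ν) = n(l^{−k(3+ρ)}ν) ≤ vol{η(τ₀,·) ≠ 0} < ∞`.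
[cite: MajdaBertozziCUP2002, §4.3 eq. (4.60)] -/
theorem angVortQuot_eq_zero_of_dss_of_finiteSupport {ρ : ℝ} (hns : IsClassicalNSSolutionOn (Iio 0) 0 0 u p)
    (hax : ∀ τ : ℝ, τ < 0 → IsAxisymmetric (u τ)) (hsw : ∀ τ : ℝ, τ < 0 → HasNoSwirl (u τ))
    (hL : ODE.IsUniformlyLipschitzOn u (Iio 0)) {l : ℝ} (hl : 1 < l)
    (hdss : ∀ τ : ℝ, τ < 0 → ∀ y, u τ y = (l ^ (1 + ρ)) • u ((l ^ (2 + ρ)) * τ) (l • y))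
    {τ₀ : ℝ} (hτ₀ : τ₀ < 0) (hfin : volume {y : EuclideanSpace ℝ (Fin 3) | angVortQuot (u τ₀) y ≠ 0} < ⊤) :
    ∀ τ : ℝ, τ < 0 → ∀ y, angVortQuot (u τ) y = 0 := by
  have ha : 0 < l ^ (3 + ρ) := Real.rpow_pos_of_pos (by linarith) _
  have hb : 1 < l ^ (3 : ℕ) := one_lt_pow₀ hl three_ne_zero
  intro τ hτ
  refine angVortQuot_eq_zero_of_null_superlevels hns hτ fun ν hν => ?_
  rw [volume_superlevel_angVortQuot_eq hns hax hsw hL hτ hτ₀ ν]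
  refine null_of_law_of_le ha hb (fun ν' => volume_superlevel_angVortQuot_law hns hax hsw hL hl hdss hτ₀ ν') hfin.ne
    (fun ν' hν' => measure_mono fun y hy => ?_) hν
  exact abs_pos.1 (hν'.trans hy)

/-- **ONE FINITE `L^q` NORM OF `η` OFF THE DSS-CRITICAL EXPONENT ON ONE SLICE ⇒ `η ≡ 0` ON EVERY SLICE**: `∫⁻ |η(τ₀,·)|^q < ∞`, `0 < q`, `q(3+ρ) ≠ 3`
(Chebyshev + the law `n(ν) = l³ n(l^{3+ρ}ν)`; e.g. `q = 2`: `2(3+ρ) ≠ 3` for every `ρ > −3/2`). [cite: MajdaBertozziCUP2002, §4.3 eq. (4.60); Chae2007CMPEuler, Thm 2.2] -/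
theorem angVortQuot_eq_zero_of_dss_of_Lq {ρ : ℝ} (hns : IsClassicalNSSolutionOn (Iio 0) 0 0 u p)
    (hax : ∀ τ : ℝ, τ < 0 → IsAxisymmetric (u τ)) (hsw : ∀ τ : ℝ, τ < 0 → HasNoSwirl (u τ))
    (hL : ODE.IsUniformlyLipschitzOn u (Iio 0)) {l : ℝ} (hl : 1 < l)
    (hdss : ∀ τ : ℝ, τ < 0 → ∀ y, u τ y = (l ^ (1 + ρ)) • u ((l ^ (2 + ρ)) * τ) (l • y))
    {τ₀ : ℝ} (hτ₀ : τ₀ < 0) {q : ℝ} (hq : 0 < q) (hq3 : q * (3 + ρ) ≠ 3)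
    (hI : ∫⁻ y, ENNReal.ofReal (|angVortQuot (u τ₀) y| ^ q) < ⊤) :
    ∀ τ : ℝ, τ < 0 → ∀ y, angVortQuot (u τ) y = 0 := by
  have hc := continuous_angVortQuot_slice hns hτ₀
  have hfm : AEMeasurable (fun y : EuclideanSpace ℝ (Fin 3) => ENNReal.ofReal (|angVortQuot (u τ₀) y| ^ q)) volume :=
    (ENNReal.continuous_ofReal.comp ((continuous_abs.comp hc).rpow_const fun _ => Or.inr hq.le)).measurable.aemeasurable
  intro τ hτ
  refine angVortQuot_eq_zero_of_null_superlevels hns hτ fun ν hν => ?_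
  rw [volume_superlevel_angVortQuot_eq hns hax hsw hL hτ hτ₀ ν]
  refine null_of_law_of_chebyshev hl (fun ν' => volume_superlevel_angVortQuot_law hns hax hsw hL hl hdss hτ₀ ν') hq3 hI.ne
    (fun ν' hν' => ?_) hν
  refine le_trans ?_ (mul_meas_ge_le_lintegral₀ hfm (ENNReal.ofReal (ν' ^ q)))
  exact mul_le_mul' le_rfl (measure_mono fun y hy =>
    ENNReal.ofReal_le_ofReal (Real.rpow_le_rpow hν'.le (le_of_lt hy) hq.le))

/-- The three one-slice `η`-hypotheses packaged: `η(τ₀,·)` bounded, OR of finite-volume support, OR with one finite `L^q` norm off `q(3+ρ) = 3`, on one slice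
`τ₀ < 0` ⇒ `curl u(τ,·) ≡ 0` on every slice (`η ≡ 0` and no swirl ⇒ irrotational, `AxisymNoSwirl.curl_eq_zero_of_angVortQuot_eq_zero`). [folklore] -/
theorem curl_slice_eq_zero_of_dss_of_eta {ρ : ℝ} (hρ : -3 < ρ) (hns : IsClassicalNSSolutionOn (Iio 0) 0 0 u p)
    (hax : ∀ τ : ℝ, τ < 0 → IsAxisymmetric (u τ)) (hsw : ∀ τ : ℝ, τ < 0 → HasNoSwirl (u τ))
    (hL : ODE.IsUniformlyLipschitzOn u (Iio 0)) {l : ℝ} (hl : 1 < l)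
    (hdss : ∀ τ : ℝ, τ < 0 → ∀ y, u τ y = (l ^ (1 + ρ)) • u ((l ^ (2 + ρ)) * τ) (l • y))
    (heta : ∃ τ₀ : ℝ, τ₀ < 0 ∧ ((∃ B : ℝ, ∀ y, |angVortQuot (u τ₀) y| ≤ B) ∨
      volume {y : EuclideanSpace ℝ (Fin 3) | angVortQuot (u τ₀) y ≠ 0} < ⊤ ∨
      ∃ q : ℝ, 0 < q ∧ q * (3 + ρ) ≠ 3 ∧ ∫⁻ y, ENNReal.ofReal (|angVortQuot (u τ₀) y| ^ q) < ⊤)) :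
    ∀ τ : ℝ, τ < 0 → ∀ x, curl (u τ) x = 0 := by
  have hη : ∀ τ : ℝ, τ < 0 → ∀ y, angVortQuot (u τ) y = 0 := by
    obtain ⟨τ₀, hτ₀, h⟩ := heta
    rcases h with ⟨B, hB⟩ | hfin | ⟨q, hq, hq3, hI⟩
    · exact angVortQuot_eq_zero_of_dss_of_bounded hρ hns hax hsw hL hl hdss hτ₀ hB
    · exact angVortQuot_eq_zero_of_dss_of_finiteSupport hns hax hsw hL hl hdss hτ₀ hfin
    · exact angVortQuot_eq_zero_of_dss_of_Lq hns hax hsw hL hl hdss hτ₀ hq hq3 hI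
  intro τ hτ x
  exact AxisymNoSwirl.curl_eq_zero_of_angVortQuot_eq_zero (hax τ hτ) (hsw τ hτ)
    ((hns.contDiff_velocity hτ).of_le (by norm_cast)) (hη τ hτ) x

end DSSEtaRatchet

/-! ### Member forms -/

namespace DSSEtaRatchet

open DSSSwirlRatchet

variable {u : ℝ → EuclideanSpace ℝ (Fin 3) → EuclideanSpace ℝ (Fin 3)} {p : ℝ → EuclideanSpace ℝ (Fin 3) → ℝ}
  {H : ℝ → EuclideanSpace ℝ (Fin 3) → EuclideanSpace ℝ (Fin 3) →L[ℝ] EuclideanSpace ℝ (Fin 3)} {c : ℝ≥0}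

/-- **MEMBER FORM (swirl-free): CLASSICAL AXISYMMETRIC SWIRL-FREE DSS MEMBER WITH A ONE-SLICE `η`-CLAUSE ⇒ TRIVIAL** — binders of
`AxisymNoSwirl.ae_eq_zero_of_gauge_of_axisymNoSwirl_dss` verbatim with `hL2` (`η ∈ L²` uniformly on compact intervals) REPLACED by the one-slice clause
`∃ τ₀ < 0, (∃ B, |η(τ₀,·)| ≤ B) ∨ vol{η(τ₀,·) ≠ 0} < ⊤ ∨ ∃ q > 0, q(3+ρ) ≠ 3 ∧ ∫⁻ ofReal(|η(τ₀,·)|^q) < ⊤`. [cite: MajdaBertozziCUP2002, §4.3 eq. (4.60)] -/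
theorem ae_eq_zero_of_gauge_of_axisymNoSwirl_dss_eta {ρ : ℝ} (hρ : 0 < ρ)
    (hH : HasWeakSpatialGradientOn (slab (EuclideanSpace ℝ (Fin 3)) (Iio 0) isOpen_Iio) u H)
    (hc : ∀ a : ℝ, 0 < a → ENNReal.ofReal (a ^ (2 * ρ)) * cknA a (0 : ℝ × EuclideanSpace ℝ (Fin 3)) u +
        ENNReal.ofReal (a ^ ρ) * cknE a (0 : ℝ × EuclideanSpace ℝ (Fin 3)) H +
        ENNReal.ofReal (a ^ (2 * ρ)) * cknD a (0 : ℝ × EuclideanSpace ℝ (Fin 3)) p ≤ (c : ℝ≥0∞))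
    (hns : IsClassicalNSSolutionOn (Iio 0) 0 0 u p)
    (hax : ∀ τ : ℝ, τ < 0 → IsAxisymmetric (u τ)) (hsw : ∀ τ : ℝ, τ < 0 → HasNoSwirl (u τ))
    {l : ℝ} (hl : 1 < l)
    (hdss : ∀ τ : ℝ, τ < 0 → ∀ y, u τ y = (l ^ (1 + ρ)) • u ((l ^ (2 + ρ)) * τ) (l • y))
    (hbdd : ∀ s t : ℝ, s < t → t < 0 → ∃ B : ℝ, ∀ τ ∈ Icc s t, ∀ y,
      ‖u τ y‖ ≤ B ∧ ‖fderiv ℝ (u τ) y‖ ≤ B)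
    (heta : ∃ τ₀ : ℝ, τ₀ < 0 ∧ ((∃ B : ℝ, ∀ y, |angVortQuot (u τ₀) y| ≤ B) ∨
      volume {y : EuclideanSpace ℝ (Fin 3) | angVortQuot (u τ₀) y ≠ 0} < ⊤ ∨
      ∃ q : ℝ, 0 < q ∧ q * (3 + ρ) ≠ 3 ∧ ∫⁻ y, ENNReal.ofReal (|angVortQuot (u τ₀) y| ^ q) < ⊤)) :
    uncurry u =ᵐ[volume.restrict (Iio (0 : ℝ) ×ˢ (univ : Set (EuclideanSpace ℝ (Fin 3))))] 0 :=
  AxisymNoSwirl.ae_eq_zero_of_gauge_of_curl_slice_eq_zero (by linarith) hH hc hns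
    (curl_slice_eq_zero_of_dss_of_eta (by linarith) hns hax hsw (isUniformlyLipschitzOn_of_bounds hns hbdd) hl hdss heta)

/-- **THE ONE-SLICE AXISYMMETRIC DSS STRATUM.**  A classical axisymmetric `l`-DSS member of the class (`0 < ρ`, `l > 1`), with `u`/`∇u` bounded on compact past intervals,
such that on ONE slice `τ₀ < 0` BOTH
(swirl) `|r u_θ| ≤ B` ∨ `vol{r u_θ ≠ 0} < ⊤` ∨ `∫⁻ ofReal(|r u_θ|^q) < ⊤` for some `q > 0` with `qρ ≠ 3`, AND
(`η`)   `|ω_θ/r| ≤ B′` ∨ `vol{ω_θ/r ≠ 0} < ⊤` ∨ `∫⁻ ofReal(|ω_θ/r|^{q′}) < ⊤` for some `q′ > 0` with `q′(3+ρ) ≠ 3`,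
is trivial.  (Swirl clause ⇒ swirl-free on every slice by `…DSSSwirlRatchet`/`…DSSSwirlCasimir`; `η` clause ⇒ irrotational slices; `A`-gauge.)  No time-uniform
integrability hypothesis remains. [cite: MajdaBertozziCUP2002, §4.3 eq. (4.60); Chae2007CMPEuler, Thm 2.2 + Note added p. 6] -/
theorem ae_eq_zero_of_gauge_of_axisym_dss_oneSlice {ρ : ℝ} (hρ : 0 < ρ)
    (hH : HasWeakSpatialGradientOn (slab (EuclideanSpace ℝ (Fin 3)) (Iio 0) isOpen_Iio) u H)
    (hc : ∀ a : ℝ, 0 < a → ENNReal.ofReal (a ^ (2 * ρ)) * cknA a (0 : ℝ × EuclideanSpace ℝ (Fin 3)) u +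
        ENNReal.ofReal (a ^ ρ) * cknE a (0 : ℝ × EuclideanSpace ℝ (Fin 3)) H +
        ENNReal.ofReal (a ^ (2 * ρ)) * cknD a (0 : ℝ × EuclideanSpace ℝ (Fin 3)) p ≤ (c : ℝ≥0∞))
    (hns : IsClassicalNSSolutionOn (Iio 0) 0 0 u p)
    (hax : ∀ τ : ℝ, τ < 0 → IsAxisymmetric (u τ))
    {l : ℝ} (hl : 1 < l)
    (hdss : ∀ τ : ℝ, τ < 0 → ∀ y, u τ y = (l ^ (1 + ρ)) • u ((l ^ (2 + ρ)) * τ) (l • y))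
    (hbdd : ∀ s t : ℝ, s < t → t < 0 → ∃ B : ℝ, ∀ τ ∈ Icc s t, ∀ y,
      ‖u τ y‖ ≤ B ∧ ‖fderiv ℝ (u τ) y‖ ≤ B)
    {τ₀ : ℝ} (hτ₀ : τ₀ < 0)
    (hswirl : (∃ B : ℝ, ∀ y, |swirl (u τ₀) y| ≤ B) ∨ volume {y : EuclideanSpace ℝ (Fin 3) | swirl (u τ₀) y ≠ 0} < ⊤ ∨
      ∃ q : ℝ, 0 < q ∧ q * ρ ≠ 3 ∧ ∫⁻ y, ENNReal.ofReal (|swirl (u τ₀) y| ^ q) < ⊤)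
    (heta : (∃ B : ℝ, ∀ y, |angVortQuot (u τ₀) y| ≤ B) ∨ volume {y : EuclideanSpace ℝ (Fin 3) | angVortQuot (u τ₀) y ≠ 0} < ⊤ ∨
      ∃ q : ℝ, 0 < q ∧ q * (3 + ρ) ≠ 3 ∧ ∫⁻ y, ENNReal.ofReal (|angVortQuot (u τ₀) y| ^ q) < ⊤) :
    uncurry u =ᵐ[volume.restrict (Iio (0 : ℝ) ×ˢ (univ : Set (EuclideanSpace ℝ (Fin 3))))] 0 := by
  have hL : ODE.IsUniformlyLipschitzOn u (Iio 0) := isUniformlyLipschitzOn_of_bounds hns hbdd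
  have hsw : ∀ τ : ℝ, τ < 0 → HasNoSwirl (u τ) := by
    rcases hswirl with ⟨B, hB⟩ | hfin | ⟨q, hq, hq3, hI⟩
    · exact hasNoSwirl_of_dss_of_bounded_swirl hρ hns hax hl hdss hbdd hτ₀ hB
    · exact hasNoSwirl_of_dss_of_finiteSwirlSupport hns hax hL hl hdss hτ₀ hfin
    · exact hasNoSwirl_of_dss_of_swirl_Lq hns hax hL hl hdss hτ₀ hq hq3 hI
  exact ae_eq_zero_of_gauge_of_axisymNoSwirl_dss_eta hρ hH hc hns hax hsw hl hdss hbdd ⟨τ₀, hτ₀, heta⟩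

end DSSEtaRatchet

end Summit.NavierStokesRegularity.NavierStokesRegularity.Theorems.PowerGaugeEulerLiouville

end
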